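import Summits.HodgeConjecture.HodgeConjecture.Theorems.SmoothHypersurfaceTopFormsResidues
import Literature.AlgebraicGeometry.HodgeTheory.GriffithsResiduesPoleOrderOne
import Literature.AlgebraicGeometry.HodgeTheory.HodgeModelTopFormOfClass
import Literature.AlgebraicGeometry.HodgeTheory.HypersurfaceLefschetzUpper
import Literature.AlgebraicTopology.CharacteristicClasses.ProjectivizationCharts
import Literature.AlgebraicGeometry.Motives.NonsingularFormIrreducible

/-!
# The geometric genus of a smooth hypersurface: `h^{n,0}(X_F) ≤ C(d-1, n+1)` — the binder PG discharged for `d ≥ n + 2`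

Prover seat `hodge-nonav-prover-Bx` (g11), cell `hodge-nonav`, programme PG-GENERAL. The named fact
PG = `Literature.AlgebraicGeometry.HodgeTheory.Arapura2012_hypersurface_geometricGenus` (`h^{n,0}(X_F) = C(d-1, n+1)` for every
nonsingular form `F` of degree `d ≥ 1` in `n + 2 ≥ 3` variables) is the binder `stub_hypersurfaceGeometricGenus` of crux K1-A
(stmt-HodgeConjecture-19544) and, through `SignSymmetricPowersFourFactsGeometricGenus.genusBound_of_geometricGenus`, of the
registered stub `stub_genusBoundThreefold` (hpg3) of crux K1-B (stmt-HodgeConjecture-19716). Its `≥` half is the tree's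
`choose_le_geometricGenus` (Griffiths' residues at pole order one). THIS FILE PROVES THE `≤` HALF FOR `d ≥ n + 2`:

* `hasHolomorphicCoords_comp_homeomorph` — transport of a holomorphic hypersurface model along a projective linear map;
* `finrank_holFormsInCharts_hodgeModel_le` — for a Hodge model `A` of `X_F` (`F` nonsingular of degree `d ≥ n + 2`),
  `dim_ℂ Ωⁿ(X_F^an) ≤ C(d-1, n+1)`: move `F` to the transversal normal form of the tree's
  `TransversalLine.exists_linSubst_transversal_line` by a linear change of coordinates and apply
  `SmoothHypersurfaceTopFormsResidues.finrank_holFormsInCharts_le` (every holomorphic top form is a Griffiths residue —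
  Serre's algebraisation lemma on the smooth affine charts);
* `geometricGenus_le_choose` — **`h^{n,0}(X_F) ≤ C(d-1, n+1)`** on the tree's Hodge structure `BettiUniverse.hodge hHD hX n`
  (`ratPieceTopEquivForms`: `Θ_A⁻¹(H^{n,0}) ≅ Ωⁿ(X^an)`), and `geometricGenus_eq_choose` — **equality** with the tree's
  lower bound, i.e. PG for `d ≥ n + 2`.

What is NOT proved here: the case `d < n + 2` of PG (`h^{n,0} = 0`; no residue frame of non-negative degree). CONDITIONAL
nowhere; sorry-free; no definition, no named fact; `--supports stmt-HodgeConjecture-19716 --as helper`; nothing here says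
HC ∕ HC_AV is proved, and rung F-H1 is not moved by this file.
-/

noncomputable section

set_option linter.dupNamespace false

open scoped Manifold ContDiff Topology LinearAlgebra.Projectivization
open Set Filter Function Projectivization Polynomial

namespace Summit.HodgeConjecture.HodgeConjecture.Theorems.SmoothHypersurfaceGeometricGenusLe

open Literature.AlgebraicGeometry.HodgeTheory Literature.AlgebraicGeometry.Motives Literature.NumberTheory.Transcendental
  Literature.Geometry.Kaehler Literature.AlgebraicTopology.CharacteristicClasses
  Summit.HodgeConjecture.HodgeConjecture.Theorems.SmoothHypersurfaceTopFormsResidues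

/-! ### Transport of a holomorphic model along a projective linear map -/

section Transport

variable {m : ℕ} {E : Type*} [NormedAddCommGroup E] [NormedSpace ℂ E]
  {M : Type*} [TopologicalSpace M] [ChartedSpace E M]
  (ψ : M → ℙ ℂ (Fin (m + 2) → ℂ)) (B : (Fin (m + 2) → ℂ) ≃L[ℂ] (Fin (m + 2) → ℂ))

omit [TopologicalSpace M] [ChartedSpace E M] in
/-- The transported model on a chart of the original one: `[B](ψ x) = [B (Z̃_{i'} x)]` for `x ∈ M_{i'}`. [folklore] -/
theorem homeomorph_comp_apply {i' : Fin (m + 2)} {x : M} (hx : x ∈ liftDomain ψ i') :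
    (homeomorphOfContinuousLinearEquiv B ∘ ψ) x =
      Projectivization.mk ℂ (B (projLift ψ i' x)) (by
        intro h; exact projLift_ne_zero ψ i' x (by simpa using congrArg B.symm h)) := by
  change Projectivization.map (B : (Fin (m + 2) → ℂ) →ₗ[ℂ] (Fin (m + 2) → ℂ)) B.injective (ψ x) = _
  conv_lhs => rw [← mk_projLift ψ hx]
  rw [Projectivization.map_mk]
  rfl

/-- **Holomorphic affine coordinates are preserved by projective linear maps**: if `ψ` has holomorphic affine
coordinates then so has `[B] ∘ ψ` (its coordinates are quotients of linear combinations of those of `ψ`). [folklore] -/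
theorem hasHolomorphicCoords_comp_homeomorph [IsManifold 𝓘(ℂ, E) ω M] (hψc : Continuous ψ)
    (hhol : HasHolomorphicCoords E ψ) :
    HasHolomorphicCoords E (homeomorphOfContinuousLinearEquiv B ∘ ψ) := by
  intro i j x₀ hx₀
  set ψ' := homeomorphOfContinuousLinearEquiv B ∘ ψ with hψ'
  set i' := residueIdx ψ x₀ with hi'
  have hx₀' : x₀ ∈ liftDomain ψ i' := residueIdx_spec ψ x₀
  -- the coordinate as a quotient near `x₀`
  set num : M → ℂ := fun x ↦ B (projLift ψ i' x) (i.succAbove j) with hnum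
  set den : M → ℂ := fun x ↦ B (projLift ψ i' x) i with hden
  have hcoord : ∀ x ∈ liftDomain ψ i' ∩ liftDomain ψ' i,
      (stdChart i : OpenPartialHomeomorph (ℙ ℂ (Fin (m + 2) → ℂ)) (Fin (m + 1) → ℂ)) (ψ' x) j = num x * (den x)⁻¹ := by
    intro x hx
    rw [stdChart_apply, hψ', homeomorph_comp_apply ψ B hx.1, stdChartFun_mk]
    exact div_eq_mul_inv _ _
  have hden_ne : ∀ x ∈ liftDomain ψ i' ∩ liftDomain ψ' i, den x ≠ 0 := by
    intro x hx
    have h := hx.2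
    rw [mem_liftDomain_iff, hψ', homeomorph_comp_apply ψ B hx.1, stdChart_source, mk_mem_stdChartSource_iff] at h
    exact h
  -- differentiability of the lift and of its image under `B`
  have hlift : MDifferentiableAt 𝓘(ℂ, E) 𝓘(ℂ, Fin (m + 2) → ℂ) (fun x ↦ B (projLift ψ i' x)) x₀ :=
    (B.toContinuousLinearMap.mdifferentiable.comp_mdifferentiableOn
      (mdifferentiableOn_projLift ψ hhol i')).mdifferentiableAt
      ((isOpen_liftDomain ψ hψc i').mem_nhds hx₀')
  have hnumd : MDifferentiableAt 𝓘(ℂ, E) 𝓘(ℂ, ℂ) num x₀ :=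
    (ContinuousLinearMap.proj (R := ℂ) (i.succAbove j)).mdifferentiable.mdifferentiableAt.comp x₀ hlift
  have hdend : MDifferentiableAt 𝓘(ℂ, E) 𝓘(ℂ, ℂ) den x₀ :=
    (ContinuousLinearMap.proj (R := ℂ) i).mdifferentiable.mdifferentiableAt.comp x₀ hlift
  have hinv : MDifferentiableAt 𝓘(ℂ, E) 𝓘(ℂ, ℂ) (fun x ↦ (den x)⁻¹) x₀ := by
    have h1 : MDifferentiableAt 𝓘(ℂ, ℂ) 𝓘(ℂ, ℂ) (fun z : ℂ ↦ z⁻¹) (den x₀) :=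
      mdifferentiableAt_iff_differentiableAt.mpr (differentiableAt_inv (hden_ne x₀ ⟨hx₀', hx₀⟩))
    exact h1.comp x₀ hdend
  have hprod : MDifferentiableAt 𝓘(ℂ, E) 𝓘(ℂ, ℂ) (fun x ↦ num x * (den x)⁻¹) x₀ := hnumd.mul hinv
  -- the coordinate agrees with the quotient near `x₀`
  have hopen : IsOpen (liftDomain ψ i' ∩ liftDomain ψ' i) :=
    (isOpen_liftDomain ψ hψc i').inter (isOpen_liftDomain ψ'
      ((homeomorphOfContinuousLinearEquiv B).continuous.comp hψc) i)
  have heq : (fun x ↦ (stdChart i : OpenPartialHomeomorph (ℙ ℂ (Fin (m + 2) → ℂ)) (Fin (m + 1) → ℂ)) (ψ' x) j)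
      =ᶠ[𝓝 x₀] fun x ↦ num x * (den x)⁻¹ := by
    filter_upwards [hopen.mem_nhds ⟨hx₀', hx₀⟩] with x hx using hcoord x hx
  exact (heq.mdifferentiableAt_iff.mpr hprod).mdifferentiableWithinAt

omit [TopologicalSpace M] [ChartedSpace E M] in
/-- **The image of the transported model**: if `ψ` maps onto `V(F)` then `[A⁻¹] ∘ ψ` maps onto `V(F ∘ A)`. [folklore] -/
theorem range_comp_homeomorph {F : MvPolynomial (Fin (m + 2)) ℂ} {d : ℕ} (hF : F.IsHomogeneous d) (hF0 : F ≠ 0)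
    (A : (Fin (m + 2) → ℂ) ≃ₗ[ℂ] (Fin (m + 2) → ℂ)) (hrange : Set.range ψ = projZeroLocus {F}) :
    Set.range (homeomorphOfContinuousLinearEquiv A.symm.toContinuousLinearEquiv ∘ ψ) =
      projZeroLocus {TransversalLine.linSubst (A : (Fin (m + 2) → ℂ) →ₗ[ℂ] (Fin (m + 2) → ℂ)) F} := by
  set G := TransversalLine.linSubst (A : (Fin (m + 2) → ℂ) →ₗ[ℂ] (Fin (m + 2) → ℂ)) F with hG
  have hGhom : G.IsHomogeneous d := TransversalLine.isHomogeneous_linSubst _ hF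
  have hGeval : ∀ z, MvPolynomial.eval z G = MvPolynomial.eval (A z) F := TransversalLine.eval_linSubst _ F
  have hG0 : G ≠ 0 := by
    intro h0
    apply hF0
    have : ∀ z, MvPolynomial.eval z F = 0 := fun z ↦ by
      have := hGeval (A.symm z); rw [h0, map_zero, LinearEquiv.apply_symm_apply] at this; exact this.symm
    exact MvPolynomial.funext fun z ↦ by rw [this, map_zero]
  have hSF : ∀ G' ∈ ({F} : Set (MvPolynomial (Fin (m + 2)) ℂ)), G'.IsHomogeneous G'.totalDegree := by
    rintro G' rfl; rwa [hF.totalDegree hF0]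
  have hSG : ∀ G' ∈ ({G} : Set (MvPolynomial (Fin (m + 2)) ℂ)), G'.IsHomogeneous G'.totalDegree := by
    rintro G' rfl; rwa [hGhom.totalDegree hG0]
  set B := A.symm.toContinuousLinearEquiv with hB
  ext p
  constructor
  · rintro ⟨x, rfl⟩
    have hx : x ∈ liftDomain ψ (residueIdx ψ x) := residueIdx_spec ψ x
    rw [homeomorph_comp_apply ψ B hx, mem_projZeroLocus_mk_iff hSG]
    intro G' hG'
    rw [Set.mem_singleton_iff.mp hG', hGeval]
    change MvPolynomial.eval (A (A.symm (projLift ψ _ x))) F = 0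
    rw [LinearEquiv.apply_symm_apply]
    exact eval_projLift_eq_zero ψ hF hrange.le hx
  · intro hp
    induction p using Projectivization.ind with
    | h w hw =>
      have hGw : MvPolynomial.eval w G = 0 := (mem_projZeroLocus_mk_iff hSG w hw).mp hp G rfl
      rw [hGeval] at hGw
      have hAw : A w ≠ 0 := fun h ↦ hw (by simpa using congrArg A.symm h)
      have hmem : Projectivization.mk ℂ (A w) hAw ∈ projZeroLocus {F} :=
        (mem_projZeroLocus_mk_iff hSF _ hAw).mpr fun G' hG' ↦ by rw [Set.mem_singleton_iff.mp hG']; exact hGw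
      rw [← hrange] at hmem
      obtain ⟨x, hx⟩ := hmem
      refine ⟨x, ?_⟩
      change Projectivization.map (B : (Fin (m + 2) → ℂ) →ₗ[ℂ] (Fin (m + 2) → ℂ)) B.injective (ψ x) = _
      rw [hx, Projectivization.map_mk]
      congr 1
      change A.symm (A w) = w
      exact A.symm_apply_apply w

end Transport


/-! ### The holomorphic top forms of a Hodge model of `X_F` -/

/-- **`dim_ℂ Ωⁿ(X_F^an) ≤ C(d-1, n+1)`** for every Hodge model of the hypersurface `X_F` of a nonsingular form `F` of degree
`d ≥ n + 2` in `n + 2 ≥ 3` variables: transport to the transversal normal form and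
`SmoothHypersurfaceTopFormsResidues.finrank_holFormsInCharts_le`. [cite: VoisinHodgeII2003, §6.1.3 Cor. 6.12 (p = 1)]
[cite: Arapura2012, §17.3 (17.3.1)] -/
theorem finrank_holFormsInCharts_hodgeModel_le {n : ℕ} (hn : 1 ≤ n) {d : ℕ} (hd : n + 2 ≤ d)
    {F : MvPolynomial (Fin (n + 2)) ℂ} (hF : F.IsHomogeneous d) (hJ : SmoothHypersurface.IsNonsingularForm ℂ F)
    (hX : IsSmoothProjective n (SmoothHypersurface.hypersurface F)) (A : HodgeModel n (SmoothHypersurface.hypersurface F)) :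
    Module.finrank ℂ ↥(holFormsInCharts A.model A.carrier n) ≤ Nat.choose (d - 1) (n + 1) := by
  classical
  haveI : CompactSpace A.carrier := A.compactSpace_carrier hX
  haveI : Nonempty A.carrier := A.nonempty_carrier hX
  haveI : NeZero n := ⟨by omega⟩
  obtain ⟨hψemb, hψrange, hhol, hjac⟩ := hypersurface_hodgeModel_coords hF hJ A
  set ψ : A.carrier → ℙ ℂ (Fin (n + 2) → ℂ) :=
    hypersurfacePoint (SmoothHypersurface.hypersurfaceι F) ∘ A.toComplexPoints with hψ
  have hirr : Irreducible F := hJ.irreducible hn (by omega) hF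
  have hF0 : F ≠ 0 := hirr.ne_zero
  -- transversal normal form
  obtain ⟨L, g, hG0, hg0, hg, hsimple⟩ := TransversalLine.exists_linSubst_transversal_line hF hirr
  set G := TransversalLine.linSubst (L : (Fin (n + 2) → ℂ) →ₗ[ℂ] (Fin (n + 2) → ℂ)) F with hGdef
  have hGhom : G.IsHomogeneous d := TransversalLine.isHomogeneous_linSubst _ hF
  have hGirr : Irreducible G := (TransversalLine.irreducible_linSubst_iff L F).mpr hirr
  have hGprime : Prime G := hGirr.prime
  have hGjac : ∀ z : Fin (n + 2) → ℂ, z ≠ 0 → MvPolynomial.eval z G = 0 →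
      ∃ j, MvPolynomial.eval z (MvPolynomial.pderiv j G) ≠ 0 :=
    isNonsingular_linSubst L (F := F) hjac
  -- the transported model
  set B : (Fin (n + 2) → ℂ) ≃L[ℂ] (Fin (n + 2) → ℂ) := L.symm.toContinuousLinearEquiv with hB
  set ψ' : A.carrier → ℙ ℂ (Fin (n + 2) → ℂ) := homeomorphOfContinuousLinearEquiv B ∘ ψ with hψ'
  have hemb' : Topology.IsEmbedding ψ' := (homeomorphOfContinuousLinearEquiv B).isEmbedding.comp hψemb
  have hrange' : Set.range ψ' = projZeroLocus {G} := range_comp_homeomorph ψ hF hF0 L hψrange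
  have hhol' : HasHolomorphicCoords A.model ψ' := hasHolomorphicCoords_comp_homeomorph ψ B hψemb.continuous hhol
  exact finrank_holFormsInCharts_le ψ' hGhom hGprime hemb' hrange' hGjac hhol' A.finrank_model hd hG0 hg0 hg hsimple

/-! ### The Hodge-level statement -/

/-- **`h^{n,0}(X_F) ≤ C(d-1, n+1)`** for a nonsingular form `F` of degree `d ≥ n + 2` in `n + 2 ≥ 3` variables, on the
tree's Hodge structure `BettiUniverse.hodge hHD hX n` (the piece `H^{n,0}` is `Θ_A⁻¹(H^{n,0}) ≅ Ωⁿ(X^an)`,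
`HodgeModel.ratPieceTopEquivForms`). The `≤` half of Arapura (17.3.1) ∕ Voisin II Cor. 6.12 at `p = 1`, PROVED.
[cite: Arapura2012, §17.3 (17.3.1)] [cite: VoisinHodgeII2003, §6.1.3 Cor. 6.12 (p = 1)] -/
theorem geometricGenus_le_choose (hHD : exists_isReal_hodgeModel) {n d : ℕ} (hn : 1 ≤ n) (hd : n + 2 ≤ d)
    {F : MvPolynomial (Fin (n + 2)) ℂ} (hF : F.IsHomogeneous d) (hJ : SmoothHypersurface.IsNonsingularForm ℂ F)
    (hX : IsSmoothProjective n (SmoothHypersurface.hypersurface F)) :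
    Module.finrank ℂ ↥((BettiUniverse.hodge hHD hX n).piece (n : ℤ) 0) ≤ Nat.choose (d - 1) (n + 1) := by
  set A := BettiUniverse.realHodgeModel hHD hX with hA
  have hp : (BettiUniverse.hodge hHD hX n).piece (n : ℤ) 0 = A.ratPiece hX n n 0 := by
    have h := A.piece_eq_ratPiece hX (BettiUniverse.realHodgeModel_isHodgeSymmetric hHD hX) (show n + 0 = n from rfl)
    rw [Nat.cast_zero] at h
    exact h
  rw [hp, (A.ratPieceTopEquivForms hX (A.topHolFormClassPQ_bijective hX)).finrank_eq]
  exact finrank_holFormsInCharts_hodgeModel_le hn hd hF hJ hX A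

/-- **The geometric genus of a smooth hypersurface: `h^{n,0}(X_F) = C(d-1, n+1)` for `d ≥ n + 2`** — the named fact
`Arapura2012_hypersurface_geometricGenus` in the range `d ≥ n + 2`, PROVED (the tree's lower bound
`choose_le_geometricGenus` and `geometricGenus_le_choose`). [cite: Arapura2012, §17.3 (17.3.1)]
[cite: VoisinHodgeII2003, §6.1.3 Cor. 6.12 (p = 1)] -/
theorem geometricGenus_eq_choose (hHD : exists_isReal_hodgeModel) {n d : ℕ} (hn : 1 ≤ n) (hd : n + 2 ≤ d)
    {F : MvPolynomial (Fin (n + 2)) ℂ} (hF : F.IsHomogeneous d) (hJ : SmoothHypersurface.IsNonsingularForm ℂ F)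
    (hX : IsSmoothProjective n (SmoothHypersurface.hypersurface F)) :
    Module.finrank ℂ ↥((BettiUniverse.hodge hHD hX n).piece (n : ℤ) 0) = Nat.choose (d - 1) (n + 1) :=
  le_antisymm (geometricGenus_le_choose hHD hn hd hF hJ hX) (choose_le_geometricGenus hHD hn hF hJ hX)

/-- **The threefold genus bound of crux K1-B for `d ≥ 5`**: `h^{3,0}(X_f) ≤ C(d-1, 4)` for every nonsingular quinary form
`f` of degree `d ≥ 5` — the registered stub `stub_genusBoundThreefold` of stmt-HodgeConjecture-19716 restricted to
`d ≥ 5` (the remaining case `d = 4`, `h^{3,0} = 0`, needs the vanishing of holomorphic top forms for `d < n + 2`).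
[cite: Arapura2012, §17.3 (17.3.1)] -/
theorem genusBoundThreefold_of_five_le ⦃d : ℕ⦄ (hd : 5 ≤ d) (f : MvPolynomial (Fin 5) ℂ) (hf : f.IsHomogeneous d)
    (hns : SmoothHypersurface.IsNonsingularForm ℂ f) (hXF : IsSmoothProjective 3 (SmoothHypersurface.hypersurface f)) :
    Module.finrank ℂ ↥((BettiUniverse.hodge exists_isReal_hodgeModel_holds hXF 3).piece 3 0) ≤ (d - 1).choose 4 := by
  have h := geometricGenus_le_choose exists_isReal_hodgeModel_holds (n := 3) (by norm_num) hd hf hns hXF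
  exact_mod_cast h

end Summit.HodgeConjecture.HodgeConjecture.Theorems.SmoothHypersurfaceGeometricGenusLe

end
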